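import Literature.Computability.AlgebraicComplexity.BorderRankMatMul323Cover
import Literature.Computability.AlgebraicComplexity.BorderRankMatMul323CertSound
import HarnessLib

/-!
# The `⟨3,2,3⟩` border apolarity test, torus-fixed candidates (IV): Weyl-group symmetry of the tests

Topic `Literature/Computability/AlgebraicComplexity`.  Theorems only.  The `(210)`/`(120)` tests of
Conner–Harper–Landsberg 2023, §3, for torus-fixed candidates `F = ⟨ω_k : k ∈ S⟩ ≤ M_⟨323⟩(C*)^⊥`
are invariant under the Weyl group `S₃(U) × S₂(V) × S₃(W)` of `GL(U) × GL(V) × GL(W)` acting by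
permutation matrices (it permutes coordinates and weight lines, up to sign), so the `322` orbit
representatives certified in `BorderRankMatMul323CertSound.lean` together with the kernel-checked
orbit cover of `BorderRankMatMul323Cover.lean` settle all `C(27,4) = 17 550` candidates:

* `rowFunA_genLine`, `rowFunB_genLine` — a generator `g` moves the test product `ω_k · e_a` to
  `± (ω_{g k} · e_{g a})` composed with the coordinate permutation;
* `finrank_genSetA_image_genLine`, `…B…` — hence the span dimensions of the test products of `S` and of
  `g • S` agree (transport by the linear equivalence `LinearEquiv.funCongrLeft`), and the same for
  all `72` group elements `actLine e` (`…_image_actLine`);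
* `MatMul323.rank_test_ge` — **for every field `K` of characteristic `0` and every set `S` of at
  least `23` of the `27` weight lines, the `(210)` products span dimension `≥ 114` or the `(120)`
  products span dimension `≥ 114`.**

## References

* A. Conner, A. Harper, J. M. Landsberg, *New lower bounds for matrix multiplication and `det₃`*,
  Forum Math. Pi 11 (2023) e17 = arXiv:1911.07981, Thm. 1.4(1) (= Thm. 1.5(1) of the journal
  version), §2.3–§2.5, §3 (tests), §4 (`M(C*)^⊥ = U* ⊗ 𝔰𝔩(V) ⊗ W`), §7.3 ("nine `𝔹`-fixed
  four-dimensional subspaces"). [ConnerHarperLandsberg2023]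
-/

noncomputable section

namespace Literature.Computability.AlgebraicComplexity

namespace MatMul323

universe u

/-! ## Kernel facts about the generators and the group elements -/

/-- The generators preserve `k < 27`. [folklore] -/
private theorem genLineNat_lt : ∀ g < 5, ∀ k < 27, genLineNat g k < 27 := by decide

/-- The group elements preserve `k < 27`. [folklore] -/
private theorem actNat_lt : ∀ e < 72, ∀ k < 27, actNat e k < 27 := by decide +kernel

/-- `actLine` computes `actNat`. [folklore] -/
private theorem actLine_val {e : ℕ} (he : e < 72) (k : Fin 27) : (actLine e k).val = actNat e k.val :=
  Nat.mod_eq_of_lt (actNat_lt e he k.val k.isLt)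

/-- A generator moves a weight vector to `±` a weight vector: `ω_{g k} = ±(ω_k ∘ g)`.
[cite: ConnerHarperLandsberg2023, §2.5 (weight vectors)] -/
theorem wvZ_genLine : ∀ (g : Fin 5) (k : Fin 27) (s : A32 × B23),
    wvZ (genLine g k) s = genSignZ g k * wvZ k (genS g s) := by
  decide +kernel

/-- The generators are involutions on `A*`-coordinates. [folklore] -/
private theorem genAFun_invol : ∀ (g : Fin 5) (a : A32), genAFun g (genAFun g a) = a := by decide

/-- The generators are involutions on `B*`-coordinates. [folklore] -/
private theorem genBFun_invol : ∀ (g : Fin 5) (b : B23), genBFun g (genBFun g b) = b := by decide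

/-- The signs square to one. [folklore] -/
private theorem genSignZ_mul_self (g : ℕ) (k : Fin 27) : genSignZ g k * genSignZ g k = 1 := by
  unfold genSignZ
  split_ifs <;> norm_num

/-- Every group element is a word in the generators: `actLine e = foldr` of its word
`wordU (e / 12) ++ wordV (e / 6 % 2) ++ wordW (e % 6)`. [folklore] -/
private theorem actLine_eq_foldr : ∀ (e : Fin 72) (k : Fin 27), actLine e k =
    ((([[], [0], [1], [0, 1], [1, 0], [0, 1, 0]] : List (List (Fin 5))).getD (e.val / 12) [] ++
      ([[], [2]] : List (List (Fin 5))).getD (e.val / 6 % 2) [] ++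
      ([[], [3], [4], [3, 4], [4, 3], [3, 4, 3]] : List (List (Fin 5))).getD (e.val % 6) []).foldr
      (fun (g : Fin 5) k => genLine g.val k) k) := by
  decide +kernel

/-- Every group element is a bijection of the weight lines (surjectivity suffices).
[folklore] -/
private theorem actLine_surjective : ∀ (e : Fin 72) (y : Fin 27), ∃ x : Fin 27, actLine e x = y := by
  decide +kernel

/-! ## The generators on the test products -/

section Relabel

variable (K : Type u) [Field K]

/-- `ω_{g k} · e_{g a} = ± (ω_k · e_a) ∘ g` for the `(210)` products.
[cite: ConnerHarperLandsberg2023, §3 (equivariance of the (210)-map)] -/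
theorem rowFunA_genLine (g : Fin 5) (k : Fin 27) (a : A32) (t : A32 × A32 × B23) :
    rowFunA K (genLine g k) (genAFun g a) t = (genSignZ g k : K) * rowFunA K k a (genTA g t) := by
  have h1 := wvZ_genLine g k (t.1, t.2.2)
  have h2 := wvZ_genLine g k (t.2.1, t.2.2)
  simp only [genS] at h1 h2
  have i1 : t.2.1 = genAFun g a ↔ genAFun g t.2.1 = a :=
    ⟨fun h => by rw [h, genAFun_invol], fun h => by rw [← h, genAFun_invol]⟩
  have i2 : t.1 = genAFun g a ↔ genAFun g t.1 = a :=
    ⟨fun h => by rw [h, genAFun_invol], fun h => by rw [← h, genAFun_invol]⟩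
  simp only [rowFunA, MatMulTwo.mul210Fun, wv, genTA]
  rw [h1, h2]
  by_cases c1 : t.2.1 = genAFun g a <;> by_cases c2 : t.1 = genAFun g a
  · rw [if_pos c1, if_pos c2, if_pos (i1.1 c1), if_pos (i2.1 c2)]; push_cast; ring
  · rw [if_pos c1, if_neg c2, if_pos (i1.1 c1), if_neg (fun h => c2 (i2.2 h))]; push_cast; ring
  · rw [if_neg c1, if_pos c2, if_neg (fun h => c1 (i1.2 h)), if_pos (i2.1 c2)]; push_cast; ring
  · rw [if_neg c1, if_neg c2, if_neg (fun h => c1 (i1.2 h)), if_neg (fun h => c2 (i2.2 h))]; simp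

/-- `ω_{g k} · e_{g b} = ± (ω_k · e_b) ∘ g` for the `(120)` products.
[cite: ConnerHarperLandsberg2023, §3 (equivariance of the (120)-map)] -/
theorem rowFunB_genLine (g : Fin 5) (k : Fin 27) (b : B23) (t : A32 × B23 × B23) :
    rowFunB K (genLine g k) (genBFun g b) t = (genSignZ g k : K) * rowFunB K k b (genTB g t) := by
  have h1 := wvZ_genLine g k (t.1, t.2.1)
  have h2 := wvZ_genLine g k (t.1, t.2.2)
  simp only [genS] at h1 h2
  have i1 : t.2.2 = genBFun g b ↔ genBFun g t.2.2 = b :=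
    ⟨fun h => by rw [h, genBFun_invol], fun h => by rw [← h, genBFun_invol]⟩
  have i2 : t.2.1 = genBFun g b ↔ genBFun g t.2.1 = b :=
    ⟨fun h => by rw [h, genBFun_invol], fun h => by rw [← h, genBFun_invol]⟩
  simp only [rowFunB, MatMulTwo.mul120Fun, wv, genTB]
  rw [h1, h2]
  by_cases c1 : t.2.2 = genBFun g b <;> by_cases c2 : t.2.1 = genBFun g b
  · rw [if_pos c1, if_pos c2, if_pos (i1.1 c1), if_pos (i2.1 c2)]; push_cast; ring
  · rw [if_pos c1, if_neg c2, if_pos (i1.1 c1), if_neg (fun h => c2 (i2.2 h))]; push_cast; ring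
  · rw [if_neg c1, if_pos c2, if_neg (fun h => c1 (i1.2 h)), if_pos (i2.1 c2)]; push_cast; ring
  · rw [if_neg c1, if_neg c2, if_neg (fun h => c1 (i1.2 h)), if_neg (fun h => c2 (i2.2 h))]; simp

/-! ## Invariance of the span dimensions -/

/-- **The `(210)`-test dimension is invariant under a generator.**
[cite: ConnerHarperLandsberg2023, §3 (equivariance of the tests)] -/
theorem finrank_genSetA_image_genLine (g : Fin 5) (S : Finset (Fin 27)) :
    Module.finrank K (Submodule.span K (genSetA K (S.image (genLine g)))) =
      Module.finrank K (Submodule.span K (genSetA K S)) := by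
  classical
  have hinv : Function.Involutive (genTA (g : ℕ)) := fun t => by
    obtain ⟨a, a', b⟩ := t
    simp only [genTA, genAFun_invol, genBFun_invol]
  let τ : (A32 × A32 × B23) ≃ (A32 × A32 × B23) := hinv.toPerm _
  let e : (A32 × A32 × B23 → K) ≃ₗ[K] (A32 × A32 × B23 → K) := LinearEquiv.funCongrLeft K K τ
  have he : ∀ (φ : A32 × A32 × B23 → K) (t), e φ t = φ (genTA g t) := fun φ t => rfl
  have hrel : ∀ (k : Fin 27) (a : A32),
      rowFunA K (genLine g k) (genAFun g a) = (genSignZ g k : K) • e (rowFunA K k a) := by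
    intro k a; funext t
    rw [Pi.smul_apply, smul_eq_mul, he, rowFunA_genLine]
  have hrel' : ∀ (k : Fin 27) (a : A32),
      e (rowFunA K k a) = (genSignZ g k : K) • rowFunA K (genLine g k) (genAFun g a) := by
    intro k a
    rw [hrel, smul_smul, ← Int.cast_mul, genSignZ_mul_self, Int.cast_one, one_smul]
  have key : Submodule.span K (genSetA K (S.image (genLine g))) =
      (Submodule.span K (genSetA K S)).map (e : _ →ₗ[K] _) := by
    apply le_antisymm
    · refine Submodule.span_le.2 ?_
      rintro _ ⟨k', hk', a', rfl⟩
      obtain ⟨k, hk, rfl⟩ := Finset.mem_image.1 hk'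
      have ha' : a' = genAFun g (genAFun g a') := (genAFun_invol g a').symm
      rw [ha', hrel]
      exact Submodule.smul_mem _ _ (Submodule.mem_map_of_mem
        (Submodule.subset_span ⟨k, hk, genAFun g a', rfl⟩))
    · rw [Submodule.map_span]
      refine Submodule.span_le.2 ?_
      rintro _ ⟨x, ⟨k, hk, a, rfl⟩, rfl⟩
      change e (rowFunA K k a) ∈ _
      rw [hrel']
      exact Submodule.smul_mem _ _
        (Submodule.subset_span ⟨genLine g k, Finset.mem_image_of_mem _ hk, genAFun g a, rfl⟩)
  rw [key]
  exact LinearEquiv.finrank_map_eq e _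

/-- **The `(120)`-test dimension is invariant under a generator.**
[cite: ConnerHarperLandsberg2023, §3 (equivariance of the tests)] -/
theorem finrank_genSetB_image_genLine (g : Fin 5) (S : Finset (Fin 27)) :
    Module.finrank K (Submodule.span K (genSetB K (S.image (genLine g)))) =
      Module.finrank K (Submodule.span K (genSetB K S)) := by
  classical
  have hinv : Function.Involutive (genTB (g : ℕ)) := fun t => by
    obtain ⟨a, b, b'⟩ := t
    simp only [genTB, genAFun_invol, genBFun_invol]
  let τ : (A32 × B23 × B23) ≃ (A32 × B23 × B23) := hinv.toPerm _
  let e : (A32 × B23 × B23 → K) ≃ₗ[K] (A32 × B23 × B23 → K) := LinearEquiv.funCongrLeft K K τ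
  have he : ∀ (φ : A32 × B23 × B23 → K) (t), e φ t = φ (genTB g t) := fun φ t => rfl
  have hrel : ∀ (k : Fin 27) (b : B23),
      rowFunB K (genLine g k) (genBFun g b) = (genSignZ g k : K) • e (rowFunB K k b) := by
    intro k b; funext t
    rw [Pi.smul_apply, smul_eq_mul, he, rowFunB_genLine]
  have hrel' : ∀ (k : Fin 27) (b : B23),
      e (rowFunB K k b) = (genSignZ g k : K) • rowFunB K (genLine g k) (genBFun g b) := by
    intro k b
    rw [hrel, smul_smul, ← Int.cast_mul, genSignZ_mul_self, Int.cast_one, one_smul]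
  have key : Submodule.span K (genSetB K (S.image (genLine g))) =
      (Submodule.span K (genSetB K S)).map (e : _ →ₗ[K] _) := by
    apply le_antisymm
    · refine Submodule.span_le.2 ?_
      rintro _ ⟨k', hk', b', rfl⟩
      obtain ⟨k, hk, rfl⟩ := Finset.mem_image.1 hk'
      have hb' : b' = genBFun g (genBFun g b') := (genBFun_invol g b').symm
      rw [hb', hrel]
      exact Submodule.smul_mem _ _ (Submodule.mem_map_of_mem
        (Submodule.subset_span ⟨k, hk, genBFun g b', rfl⟩))
    · rw [Submodule.map_span]
      refine Submodule.span_le.2 ?_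
      rintro _ ⟨x, ⟨k, hk, b, rfl⟩, rfl⟩
      change e (rowFunB K k b) ∈ _
      rw [hrel']
      exact Submodule.smul_mem _ _
        (Submodule.subset_span ⟨genLine g k, Finset.mem_image_of_mem _ hk, genBFun g b, rfl⟩)
  rw [key]
  exact LinearEquiv.finrank_map_eq e _

/-- Invariance under a word in the generators. [cite: ConnerHarperLandsberg2023, §3] -/
theorem finrank_genSet_image_foldr (l : List (Fin 5)) (S : Finset (Fin 27)) :
    Module.finrank K (Submodule.span K (genSetA K (S.image fun k => l.foldr (fun (g : Fin 5) k => genLine g.val k) k))) =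
        Module.finrank K (Submodule.span K (genSetA K S)) ∧
      Module.finrank K (Submodule.span K (genSetB K (S.image fun k => l.foldr (fun (g : Fin 5) k => genLine g.val k) k))) =
        Module.finrank K (Submodule.span K (genSetB K S)) := by
  classical
  induction l generalizing S with
  | nil =>
    have hid : (fun k : Fin 27 => ([] : List (Fin 5)).foldr (fun (g : Fin 5) k => genLine g.val k) k) =
        id := rfl
    rw [hid, Finset.image_id]
    exact ⟨rfl, rfl⟩
  | cons g l ih =>
    have hcomp : (fun k : Fin 27 => (g :: l).foldr (fun (g : Fin 5) k => genLine g.val k) k) =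
        (genLine g) ∘ (fun k => l.foldr (fun (g : Fin 5) k => genLine g.val k) k) := by
      funext k; rfl
    rw [hcomp, ← Finset.image_image]
    obtain ⟨ihA, ihB⟩ := ih S
    exact ⟨(finrank_genSetA_image_genLine K g _).trans ihA,
      (finrank_genSetB_image_genLine K g _).trans ihB⟩

/-- **Invariance of both test dimensions under all `72` group elements.**
[cite: ConnerHarperLandsberg2023, §3 (equivariance of the tests)] -/
theorem finrank_genSet_image_actLine (e : Fin 72) (S : Finset (Fin 27)) :
    Module.finrank K (Submodule.span K (genSetA K (S.image (actLine e)))) =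
        Module.finrank K (Submodule.span K (genSetA K S)) ∧
      Module.finrank K (Submodule.span K (genSetB K (S.image (actLine e)))) =
        Module.finrank K (Submodule.span K (genSetB K S)) := by
  have hfun : actLine (e : ℕ) = fun k =>
      ((([[], [0], [1], [0, 1], [1, 0], [0, 1, 0]] : List (List (Fin 5))).getD (e.val / 12) [] ++
        ([[], [2]] : List (List (Fin 5))).getD (e.val / 6 % 2) [] ++
        ([[], [3], [4], [3, 4], [4, 3], [3, 4, 3]] : List (List (Fin 5))).getD (e.val % 6) []).foldr
        (fun (g : Fin 5) k => genLine g.val k) k) := funext (actLine_eq_foldr e)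
  rw [hfun]
  exact finrank_genSet_image_foldr K _ S

end Relabel

/-! ## The test for all torus-fixed candidates -/

section Main

variable (K : Type u) [Field K] [CharZero K]

/-- **Soundness: every torus-fixed candidate fails a test.** For every field `K` of characteristic
`0` and every set `S` of at least `23` of the `27` weight lines of `M_⟨323⟩(C*)^⊥`, the `(210)`
products `{ω_k · e_a : k ∈ S, a}` span dimension `≥ 114` or the `(120)` products
`{ω_k · e_b : k ∈ S, b}` span dimension `≥ 114` (`> 126 − 13`): the `⟨3,2,3⟩`, `r = 13` case of the
border apolarity tests of CHL 2023, §3, for ALL torus-fixed `F₁₁₀` (orbit representatives by the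
kernel certificate, the rest by the Weyl-group symmetry; their §7.3 treats the nine Borel-fixed
candidates of `M_⟨233⟩`). [cite: ConnerHarperLandsberg2023, Thm. 1.4(1) and §7.3 (the (210)- and (120)-tests for M_⟨233⟩)] -/
theorem rank_test_ge (S : Finset (Fin 27)) (hS : 23 ≤ S.card) :
    114 ≤ Module.finrank K (Submodule.span K (genSetA K S)) ∨
      114 ≤ Module.finrank K (Submodule.span K (genSetB K S)) := by
  classical
  -- four weight lines outside of which everything lies in `S`, sorted
  have hc : Sᶜ.card ≤ 4 := by
    rw [Finset.card_compl, Fintype.card_fin]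
    omega
  obtain ⟨T₀, hT₀, -, hT₀c⟩ :=
    Finset.exists_subsuperset_card_eq (Finset.subset_univ Sᶜ) hc (by simp)
  set f := T₀.orderEmbOfFin hT₀c with hf
  have h01 : f 0 < f 1 := f.strictMono (by decide)
  have h12 : f 1 < f 2 := f.strictMono (by decide)
  have h23 : f 2 < f 3 := f.strictMono (by decide)
  obtain ⟨he, T, hT, ha, hb, hc', hd⟩ := cover_spec (a := (f 0).val) (b := (f 1).val)
    (c := (f 2).val) (d := (f 3).val) (Fin.lt_def.1 h01) (Fin.lt_def.1 h12) (Fin.lt_def.1 h23)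
    (f 3).isLt
  set g := tab4 (f 0).val (f 1).val (f 2).val (f 3).val with hg
  -- the moved set contains every line outside the representative `T`
  set S' := S.image (actLine g) with hS'
  have hcov : ∀ k : Fin 27, k.val ∉ T → k ∈ S' := by
    intro k hk
    obtain ⟨x, rfl⟩ := actLine_surjective ⟨g, he⟩ k
    by_cases hx : x ∈ S
    · exact Finset.mem_image_of_mem _ hx
    · exfalso
      apply hk
      have hxT : x ∈ (T₀ : Set (Fin 27)) := hT₀ (Finset.mem_compl.2 hx)
      rw [← Finset.range_orderEmbOfFin T₀ hT₀c, Set.mem_range] at hxT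
      obtain ⟨j, hj⟩ := hxT
      rw [← hf] at hj
      change (actLine g x).val ∈ T
      rw [actLine_val he, ← hj]
      fin_cases j
      · exact ha
      · exact hb
      · exact hc'
      · exact hd
  obtain ⟨hA, hB⟩ := finrank_genSet_image_actLine K ⟨g, he⟩ S
  rcases rank_test_ge_of_omits K hT S' hcov with h | h
  · left; rwa [hS', hA] at h
  · right; rwa [hS', hB] at h

end Main

end MatMul323

end Literature.Computability.AlgebraicComplexity

end
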